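import Literature.NumberTheory.GelbartRogawski1991.DoubledUnitaryGlobalSplittingDataGen
import Literature.NumberTheory.Weil1964.ArchPhaseMapLagrangianBlock
import Literature.NumberTheory.Weil1964.ArchPhaseMapSymplectic
import Literature.NumberTheory.Weil1964.ArchSectionThetaMajorants
import Literature.NumberTheory.Weil1964.ArchCovariantSchur
import Literature.NumberTheory.Weil1964.AdelicThetaWitness
import Literature.NumberTheory.GelbartRogawski1991.DoubledWeilRepresentationArchLagrangian
import HarnessLib

/-!
# The doubled Weil representation, archimedean half (I): the element `δ` carries the diagonal Lagrangian onto `𝕐`,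
# and the `𝕐`-block of `δ ι^𝔻(p) δ⁻¹` at `∞` for `p` in the Siegel parabolic `P_Δ` — general `E/F`

General-quadratic-extension twin (namespace `GRConstructionGen`) of `DoubledWeilRepresentationArchLagrangian` (CM case,
namespace `GRConstruction`): the CM field `L ⊃ L⁺` with complex conjugation and `realDiagonal` Gram data is replaced by an
arbitrary quadratic extension `E/F` of number fields with `c ∈ Aut(E/F)`, `c δ = -δ ≠ 0`, `δ² = d ∈ F`, and symmetric
invertible Gram matrices `TV`, `TW` over `F` (objects of `DoubledUnitaryGlobalSplittingDataGen`).  Statements and proofs are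
verbatim transports.

([GelbartRogawski1991, §3.1 Prop. 3.1.1 p. 455]: archimedean places of the kernel construction of the compatible
splitting; [Kudla1994, §3]: `P_Δ = M N`, the Levi acts on `Δ` through `a`; [Folland1989, §4.2 (4.24)]: the real
polarisation `(x, ξ)` of `𝓢`)

Topic `NumberTheory/GelbartRogawski1991`; namespace `Literature.NumberTheory.GelbartRogawski1991.GRConstruction`
(the vocabulary of `DoubledUnitaryGlobalSplittingData`: `gramR`, `gramD`, `gramDA`, `hermD`, `HA`, `blk`, `IsSiegelDelta`,
`deltaBlock`, `toSpD`, `projD`, `deltaD`, `rDelta`).  KERNEL only: proved theorems; no definition, no named fact, no `sorry`.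

Setting: the doubled hermitian space `𝔻 = 𝕍 ⊕ (−𝕍)` of the CM splitting datum (`T^𝔻 = e₂ (T ⊕ −T) e₂`, `T = gramR`,
`H(𝔸) = U(J^𝔻)(𝔸_{L⁺})`), its symplectic module `𝕎^𝔻_𝔸 = 𝔸^{n+n} × 𝔸^{n+n}` (`polar (adelicForm T^𝔻 ⊗ 1)`), the
rational symplectic element `δ = deltaD` (`DoublingDiagonalPolarisation.deltaDiagMatrix` re-enumerated by `e₂ ⊕ e₂`) with
`r_F^𝔻(δ) = rDelta`, and the archimedean coordinates `archVec ∕ piArch ∕ archAct ∕ archFolland ∕ archPhaseMap ∕ freqFrame`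
of the `Weil1964` files in an arbitrary real frame `eW : (L⁺ ⊗ ℝ)^{n+n} ≃L[ℝ] ℝ^σ`.  A *diagonal pair* is
`((a, a), (z, z))` re-enumerated by `e₂` — the `X ∕ Y` coordinates of a vector of the diagonal `Δ ⊂ 𝔻`.

* §1 block bookkeeping (`Sum.elim` under `e₂ ⊕ e₂`, `mulVec` in a re-enumeration, `det T` a unit, the matrix of `δ`);
* §2 **`conj_deltaD_toSpD_apply_zero_fst`** — for `p ∈ P_Δ(𝔸)` the conjugate `δ ι^𝔻(p) δ⁻¹` preserves the Lagrangian
  `𝕐 = 0 × 𝔸^{n+n}`: `δ` maps the diagonal pair `((a,a),(z,z))` to `(0, (T^𝔻)⁻¹(T z, −a))` (`ratSp_deltaD_apply_diag`), every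
  `(0, y)` is such an image (`exists_ratSp_deltaD_apply_diag_eq`), and `ι^𝔻(p)` maps diagonal pairs to diagonal pairs
  (`toSpD_apply_diag`, through `δ_Δ(p) = deltaBlock p` in the quadratic coordinates `X = x + y δ`);
* §3 the same at `∞` in a real frame `eW`: a frame `ψ` of `𝕐_∞` by diagonal archimedean pairs (`exists_yFrame_diag`), and
  **`det_yBlock_eq_det`** — if the archimedean action of `q ∈ Sp(𝕎^𝔻_𝔸)` maps diagonal pairs to diagonal pairs through
  a real-linear `A`, then the `𝕐`-block `d` of `δ q δ⁻¹` in the frame `eW` is `ψ A ψ⁻¹`, so `det d = det A`.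

This is the Lagrangian bookkeeping behind the parabolic normalisation `χ(det_Δ p)|det_Δ p|^{1/2}` of the archimedean half
of the doubled Weil representation (sequel `DoubledWeilRepresentationArchHalf`); written for the stage-1 cell `pub-hodgecm`
(seat GR-3).  Nothing here is a claim of the manuscripts adjudicated by that cell.

## References

* S. Gelbart, J. Rogawski, *L-functions and Fourier–Jacobi coefficients for the unitary group U(3)*, Invent. Math. 105
  (1991), §3.1 Prop. 3.1.1 p. 455 [GelbartRogawski1991].
* S. S. Kudla, *Splitting metaplectic covers of dual reductive pairs*, Israel J. Math. 87 (1994) 361–401, §3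
  [Kudla1994].
* M. Harris, S. S. Kudla, W. J. Sweet, *Theta dichotomy for unitary groups*, J. Amer. Math. Soc. 9 (1996), §1
  (1.11)–(1.15) (the doubled space `𝕍 ⊕ −𝕍`, `Δ`, `P_Δ`) [HarrisKudlaSweet1996].
* G. B. Folland, *Harmonic Analysis in Phase Space*, Princeton UP 1989, §4.2 (4.24) [Folland1989].
-/

set_option autoImplicit false

noncomputable section

open scoped Classical
open scoped Matrix Kronecker TensorProduct
open NumberField IsDedekindDomain
open Literature.RepresentationTheory.HeisenbergGroup
open Literature.NumberTheory.Automorphic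
open Literature.NumberTheory.Weil1964
open Literature.NumberTheory.GaloisRepresentations

namespace Literature.NumberTheory.GelbartRogawski1991.GRConstructionGen

open UnitaryDualPair

variable (F : Type) [Field F] [NumberField F] (E : Type) [Field E] [NumberField E] [Algebra F E]
  [Algebra.IsQuadraticExtension F E]
variable (c : E ≃ₐ[F] E) {δ : E} (hcδ : c δ = -δ) (hδ : δ ≠ 0) {d : F} (hd : δ * δ = algebraMap F E d)
variable {N M n : ℕ} (e : Fin N × Fin M ≃ Fin n)
  (TV : Matrix (Fin N) (Fin N) F) (hV : TV.IsSymm) (hVd : IsUnit TV.det)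
  (TW : Matrix (Fin M) (Fin M) F) (hW : TW.IsSymm) (hWd : IsUnit TW.det)

/-! ## §1 Block bookkeeping -/

section Bookkeeping

include hVd hWd in
omit [NumberField F] in
/-- `det T` (the undoubled real Gram matrix) is a unit. [cite: GelbartRogawski1991, §3.1 Prop. 3.1.1 p. 455] -/
theorem isUnit_det_gramR₀ : IsUnit (gramR F e TV TW).det := by
  unfold gramR
  exact isUnit_det_gram F e hVd hWd

omit [NumberField F] [Algebra.IsQuadraticExtension F E] in
/-- the matrix of `δ`. [cite: Kudla1994, §3] -/
theorem coe_deltaD' : ((deltaD F : Matrix.symplecticGroup (Fin (n + n)) F) :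
    Matrix (Fin (n + n) ⊕ Fin (n + n)) (Fin (n + n) ⊕ Fin (n + n)) F) =
      Matrix.reindex ((e₂ (n := n)).sumCongr (e₂ (n := n))) ((e₂ (n := n)).sumCongr (e₂ (n := n)))
        (deltaDiagMatrix F (Fin n)) := rfl

include hVd hWd in
/-- the archimedean part of `T^𝔻 ⊗ 1` is invertible. [cite: GelbartRogawski1991, §3.1 Prop. 3.1.1 p. 455] -/
theorem isUnit_archMat_gramDA : IsUnit (archMat F (Fin (n + n)) (gramDA F e TV TW)) :=
  isUnit_archMat_of_isUnit _
    ((Matrix.isUnit_iff_isUnit_det _).2 (isUnit_det_gramDA F e TV hVd TW hWd))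

end Bookkeeping

/-! ## §2 `δ ι^𝔻(p) δ⁻¹` preserves the Lagrangian `𝕐` for `p ∈ P_Δ(𝔸)` -/

section SiegelLagrangian

open Literature.RepresentationTheory.HeisenbergGroup.SymplecticMatrix

/-- `T^𝔻 ⊗ 1 = reindex e₂ e₂ ((T ⊗ 1) ⊕ (−T ⊗ 1))`. [cite: HarrisKudlaSweet1996, §1 (1.11)–(1.15)] -/
theorem gramDA_eq_reindex : gramDA F e TV TW =
    Matrix.reindex (e₂ (n := n)) (e₂ (n := n)) (Matrix.fromBlocks (((gramR F e TV TW).map (algebraMap F (AdeleRing (𝓞 F) F)))) 0 0 (-((gramR F e TV TW).map (algebraMap F (AdeleRing (𝓞 F) F))))) := by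
  unfold gramDA gramD
  rw [Matrix.reindex_apply, Matrix.reindex_apply, ← Matrix.submatrix_map, Matrix.fromBlocks_map, Matrix.map_zero _ (map_zero _),
    Matrix.map_neg _ (map_neg _)]

/-- `(T^𝔻 ⊗ 1) (z, z) = (T z, −T z)` in the block enumeration. [cite: HarrisKudlaSweet1996, §1 (1.11)–(1.15)] -/
theorem gramDA_mulVec_diag (z : Fin n → AdeleRing (𝓞 F) F) :
    gramDA F e TV TW *ᵥ (Sum.elim z z ∘ ⇑(e₂ (n := n)).symm) =
      Sum.elim (((gramR F e TV TW).map (algebraMap F (AdeleRing (𝓞 F) F))) *ᵥ z) (-(((gramR F e TV TW).map (algebraMap F (AdeleRing (𝓞 F) F))) *ᵥ z)) ∘ ⇑(e₂ (n := n)).symm := by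
  have h1 : Matrix.reindex (e₂ (n := n)).symm (e₂ (n := n)).symm (gramDA F e TV TW) =
      Matrix.fromBlocks (((gramR F e TV TW).map (algebraMap F (AdeleRing (𝓞 F) F)))) 0 0 (-((gramR F e TV TW).map (algebraMap F (AdeleRing (𝓞 F) F)))) := by
    rw [gramDA_eq_reindex]; exact (Matrix.reindex (e₂ (n := n)) (e₂ (n := n))).symm_apply_apply _
  rw [GRConstruction.mulVec_comp_equiv_symm', h1, Matrix.fromBlocks_mulVec, Sum.elim_comp_inl, Sum.elim_comp_inr, Matrix.zero_mulVec,
    Matrix.neg_mulVec, add_zero, zero_add]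

omit [Algebra.IsQuadraticExtension F E] in
/-- the matrix of `δ` read in `𝔸_{L⁺}`. [cite: Kudla1994, §3] -/
theorem coe_mapHom_deltaD :
    ((mapHom (algebraMap F (AdeleRing (𝓞 F) F)) (deltaD F) : Matrix.symplecticGroup (Fin (n + n)) _) :
        Matrix (Fin (n + n) ⊕ Fin (n + n)) (Fin (n + n) ⊕ Fin (n + n)) (AdeleRing (𝓞 F) F)) =
      Matrix.reindex ((e₂ (n := n)).sumCongr (e₂ (n := n))) ((e₂ (n := n)).sumCongr (e₂ (n := n)))
        (deltaDiagMatrix (AdeleRing (𝓞 F) F) (Fin n)) := by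
  rw [coe_mapHom, coe_deltaD', Matrix.reindex_apply, Matrix.reindex_apply, ← Matrix.submatrix_map, deltaDiagMatrix_map]

/-- **`δ_𝔸` maps a Darboux-diagonal vector to `𝕐`**: `δ (P (a,a; z,z)) = (0; (T z, −a))` (adelic twin of `deltaD_mulVec_diag`). [cite: Kudla1994, §3] -/
theorem mapHom_deltaD_mulVec_diag (a z : Fin n → AdeleRing (𝓞 F) F) :
    ((mapHom (algebraMap F (AdeleRing (𝓞 F) F)) (deltaD F) : Matrix.symplecticGroup (Fin (n + n)) _) :
        Matrix (Fin (n + n) ⊕ Fin (n + n)) (Fin (n + n) ⊕ Fin (n + n)) (AdeleRing (𝓞 F) F)) *ᵥ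
        Sum.elim (Sum.elim a a ∘ ⇑(e₂ (n := n)).symm) (gramDA F e TV TW *ᵥ (Sum.elim z z ∘ ⇑(e₂ (n := n)).symm)) =
      Sum.elim (0 : Fin (n + n) → _) (Sum.elim (((gramR F e TV TW).map (algebraMap F (AdeleRing (𝓞 F) F))) *ᵥ z) (-a) ∘ ⇑(e₂ (n := n)).symm) := by
  have h1 : Matrix.reindex ((e₂ (n := n)).sumCongr (e₂ (n := n))).symm ((e₂ (n := n)).sumCongr (e₂ (n := n))).symm
      ((mapHom (algebraMap F (AdeleRing (𝓞 F) F)) (deltaD F) : Matrix.symplecticGroup (Fin (n + n)) _) :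
        Matrix (Fin (n + n) ⊕ Fin (n + n)) (Fin (n + n) ⊕ Fin (n + n)) (AdeleRing (𝓞 F) F)) =
      deltaDiagMatrix (AdeleRing (𝓞 F) F) (Fin n) := by
    rw [coe_mapHom_deltaD]; exact (Matrix.reindex _ _).symm_apply_apply _
  rw [gramDA_mulVec_diag, ← GRConstruction.sumElim_comp_sumCongr_e₂_symm', GRConstruction.mulVec_comp_equiv_symm', h1, deltaDiagMatrix_mulVec_diag,
    GRConstruction.sumElim_comp_sumCongr_e₂_symm']
  rfl

include hVd hWd in
/-- `π(r_F^𝔻(δ)) = δ` (the tree's `ratSp` transport of `deltaD` to `Sp(𝕎^𝔻_𝔸)`).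
[cite: GelbartRogawski1991, §3.1 Prop. 3.1.1 p. 455] -/
theorem projD_rDelta : projD F e TV TW (rDelta F e TV hVd TW hWd) =
    ratSp F (gramDA F e TV TW) (isUnit_det_gramDA F e TV hVd TW hWd) (deltaD F) :=
  proj_ratThetaLiftCont F (gramDA F e TV TW) (isUnit_det_gramDA F e TV hVd TW hWd) (deltaD F)

/-- **`δ` in `Sp(𝕎^𝔻_𝔸)` carries a diagonal pair to `𝕐`**: `δ (a,a; z,z) = (0, (T^𝔻)⁻¹(T z, −a))`. [cite: Kudla1994, §3] -/
theorem ratSp_deltaD_apply_diag (a z : Fin n → AdeleRing (𝓞 F) F) :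
    ((ratSp F (gramDA F e TV TW) (isUnit_det_gramDA F e TV hVd TW hWd) (deltaD F)).1 : _ ≃ₗ[AdeleRing (𝓞 F) F] _)
        (Sum.elim a a ∘ ⇑(e₂ (n := n)).symm, Sum.elim z z ∘ ⇑(e₂ (n := n)).symm) =
      (0, (gramDA F e TV TW)⁻¹ *ᵥ (Sum.elim (((gramR F e TV TW).map (algebraMap F (AdeleRing (𝓞 F) F))) *ᵥ z) (-a) ∘ ⇑(e₂ (n := n)).symm)) := by
  show ((transportSp (gramDA F e TV TW) (isUnit_det_gramDA F e TV hVd TW hWd)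
    (mapHom (algebraMap F (AdeleRing (𝓞 F) F)) (deltaD F)) : symplecticGroup _).1 :
      _ ≃ₗ[AdeleRing (𝓞 F) F] _) _ = _
  rw [coe_transportSp_apply, darboux_apply, mapHom_deltaD_mulVec_diag, darboux_symm_sumElim]

include hVd hWd in
/-- every `(0, y) ∈ 𝕐(𝔸)` is the `δ`-image of a diagonal pair. [cite: Kudla1994, §3] -/
theorem exists_ratSp_deltaD_apply_diag_eq (y : Fin (n + n) → AdeleRing (𝓞 F) F) :
    ∃ a z : Fin n → AdeleRing (𝓞 F) F,
      ((ratSp F (gramDA F e TV TW) (isUnit_det_gramDA F e TV hVd TW hWd) (deltaD F)).1 : _ ≃ₗ[AdeleRing (𝓞 F) F] _)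
          (Sum.elim a a ∘ ⇑(e₂ (n := n)).symm, Sum.elim z z ∘ ⇑(e₂ (n := n)).symm) = (0, y) := by
  have hR : IsUnit (((gramR F e TV TW).map (algebraMap F (AdeleRing (𝓞 F) F)))).det := by
    rw [← RingHom.mapMatrix_apply, ← RingHom.map_det]
    exact (isUnit_det_gramR₀ F e TV hVd TW hWd).map _
  set y' := gramDA F e TV TW *ᵥ y with hy'
  refine ⟨-(y' ∘ ⇑(e₂ (n := n)) ∘ Sum.inr), (((gramR F e TV TW).map (algebraMap F (AdeleRing (𝓞 F) F))))⁻¹ *ᵥ (y' ∘ ⇑(e₂ (n := n)) ∘ Sum.inl), ?_⟩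
  rw [ratSp_deltaD_apply_diag F e TV hVd TW hWd, Matrix.mulVec_mulVec, Matrix.mul_nonsing_inv _ hR, Matrix.one_mulVec, neg_neg]
  refine Prod.ext rfl ?_
  have h2 : Sum.elim (y' ∘ ⇑(e₂ (n := n)) ∘ Sum.inl) (y' ∘ ⇑(e₂ (n := n)) ∘ Sum.inr) ∘ ⇑(e₂ (n := n)).symm = y' := by
    funext j
    obtain ⟨k, rfl⟩ := (e₂ (n := n)).surjective j
    simp only [Function.comp_apply, Equiv.symm_apply_apply]
    rcases k with k | k <;> rfl
  show (gramDA F e TV TW)⁻¹ *ᵥ _ = y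
  rw [h2, hy', Matrix.mulVec_mulVec, Matrix.nonsing_inv_mul _ (isUnit_det_gramDA F e TV hVd TW hWd), Matrix.one_mulVec]

omit [NumberField F] [Algebra.IsQuadraticExtension F E] in
/-- a Siegel `p ∈ P_Δ(𝔸)` maps diagonal vectors `(W, W)` to `(δ_Δ(p) W, δ_Δ(p) W)`. [cite: Kudla1994, §3] -/
theorem mulVec_diag_of_isSiegelDelta (p : HA F E c e TV TW) (hS : IsSiegelDelta F E c e TV TW p)
    (W : Fin n → AdeleRing (𝓞 E) E) :
    ((p : GL (Fin (n + n)) (AdeleRing (𝓞 E) E)) : Matrix (Fin (n + n)) (Fin (n + n)) (AdeleRing (𝓞 E) E)) *ᵥ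
        (Sum.elim W W ∘ ⇑(e₂ (n := n)).symm) =
      Sum.elim (deltaBlock F E c e TV TW p *ᵥ W) (deltaBlock F E c e TV TW p *ᵥ W) ∘ ⇑(e₂ (n := n)).symm := by
  rw [GRConstruction.mulVec_comp_equiv_symm']
  have h1 : blk F E c e TV TW p *ᵥ Sum.elim W W =
      Sum.elim (((blk F E c e TV TW p).toBlocks₁₁ + (blk F E c e TV TW p).toBlocks₁₂) *ᵥ W)
        (((blk F E c e TV TW p).toBlocks₂₁ + (blk F E c e TV TW p).toBlocks₂₂) *ᵥ W) := by
    conv_lhs => rw [← Matrix.fromBlocks_toBlocks (blk F E c e TV TW p)]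
    rw [Matrix.fromBlocks_mulVec, Sum.elim_comp_inl, Sum.elim_comp_inr, Matrix.add_mulVec, Matrix.add_mulVec]
  have hS' : (blk F E c e TV TW p).toBlocks₁₁ + (blk F E c e TV TW p).toBlocks₁₂ =
      (blk F E c e TV TW p).toBlocks₂₁ + (blk F E c e TV TW p).toBlocks₂₂ := hS
  rw [show Matrix.reindex (e₂ (n := n)).symm (e₂ (n := n)).symm
      ((p : GL (Fin (n + n)) (AdeleRing (𝓞 E) E)) : Matrix (Fin (n + n)) (Fin (n + n)) (AdeleRing (𝓞 E) E)) =
      blk F E c e TV TW p from rfl, h1]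
  unfold deltaBlock
  rw [hS']

/-- **`ι^𝔻(p)` of a Siegel `p` maps a diagonal pair to the diagonal pair of `δ_Δ(p)`-transformed coordinates.** [cite: Kudla1994, §3] -/
theorem toSpD_apply_diag (p : HA F E c e TV TW) (hS : IsSiegelDelta F E c e TV TW p)
    (a z : Fin n → AdeleRing (𝓞 F) F) :
    ((toSpD F E c hcδ hδ hd e TV hV TW hW p).1 : _ ≃ₗ[AdeleRing (𝓞 F) F] _)
        (Sum.elim a a ∘ ⇑(e₂ (n := n)).symm, Sum.elim z z ∘ ⇑(e₂ (n := n)).symm) =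
      (Sum.elim (fun i => UnitaryGroup.QuadraticCoordinates.re (UnitaryGroup.quadraticAdeleEquiv F E c hcδ hδ).toAddEquiv ((deltaBlock F E c e TV TW p *ᵥ fun i => (UnitaryGroup.quadraticAdeleEquiv F E c hcδ hδ).toAddEquiv (a i, z i)) i))
          (fun i => UnitaryGroup.QuadraticCoordinates.re (UnitaryGroup.quadraticAdeleEquiv F E c hcδ hδ).toAddEquiv ((deltaBlock F E c e TV TW p *ᵥ fun i => (UnitaryGroup.quadraticAdeleEquiv F E c hcδ hδ).toAddEquiv (a i, z i)) i)) ∘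
          ⇑(e₂ (n := n)).symm,
        Sum.elim (fun i => UnitaryGroup.QuadraticCoordinates.im (UnitaryGroup.quadraticAdeleEquiv F E c hcδ hδ).toAddEquiv ((deltaBlock F E c e TV TW p *ᵥ fun i => (UnitaryGroup.quadraticAdeleEquiv F E c hcδ hδ).toAddEquiv (a i, z i)) i))
          (fun i => UnitaryGroup.QuadraticCoordinates.im (UnitaryGroup.quadraticAdeleEquiv F E c hcδ hδ).toAddEquiv ((deltaBlock F E c e TV TW p *ᵥ fun i => (UnitaryGroup.quadraticAdeleEquiv F E c hcδ hδ).toAddEquiv (a i, z i)) i)) ∘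
          ⇑(e₂ (n := n)).symm) := by
  have h1 : (Sum.elim a a ∘ ⇑(e₂ (n := n)).symm, Sum.elim z z ∘ ⇑(e₂ (n := n)).symm) =
      UnitaryGroup.QuadraticCoordinates.reIm (UnitaryGroup.quadraticAdeleEquiv F E c hcδ hδ).toAddEquiv (Fin (n + n))
        (Sum.elim (fun i => (UnitaryGroup.quadraticAdeleEquiv F E c hcδ hδ).toAddEquiv (a i, z i)) (fun i => (UnitaryGroup.quadraticAdeleEquiv F E c hcδ hδ).toAddEquiv (a i, z i)) ∘ ⇑(e₂ (n := n)).symm) := by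
    rw [← GRConstruction.reIm_symm_diag' (UnitaryGroup.quadraticAdeleEquiv F E c hcδ hδ).toAddEquiv a z, AddEquiv.apply_symm_apply]
  rw [h1]
  show ((UnitaryGroup.adelicToSymplectic F E c (n + n) hcδ
    hδ hd (gramD_isSymm F e TV hV TW hW) rfl p).1 : _ ≃ₗ[AdeleRing (𝓞 F) F] _)
      (UnitaryGroup.QuadraticCoordinates.reIm (UnitaryGroup.quadraticAdeleEquiv F E c hcδ hδ).toAddEquiv (Fin (n + n)) _) = _
  rw [UnitaryGroup.adelicToSymplectic_reIm, mulVec_diag_of_isSiegelDelta F E c e TV TW p hS, GRConstruction.reIm_diag']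

include hVd hWd in
/-- **U1a: `δ ι^𝔻(p) δ⁻¹ ∈ P_𝕐(𝔸)` for `p ∈ P_Δ(𝔸)`** — it preserves the Lagrangian `𝕐 = 0 × 𝔸^{n+n}`. [cite: Kudla1994, §3] -/
theorem conj_deltaD_toSpD_apply_zero_fst (p : HA F E c e TV TW) (hS : IsSiegelDelta F E c e TV TW p)
    (y : Fin (n + n) → AdeleRing (𝓞 F) F) :
    (((ratSp F (gramDA F e TV TW) (isUnit_det_gramDA F e TV hVd TW hWd) (deltaD F) * toSpD F E c hcδ hδ hd e TV hV TW hW p * (ratSp F (gramDA F e TV TW) (isUnit_det_gramDA F e TV hVd TW hWd) (deltaD F))⁻¹).1 :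
        _ ≃ₗ[AdeleRing (𝓞 F) F] _) (0, y)).1 = 0 := by
  obtain ⟨a, z, haz⟩ := exists_ratSp_deltaD_apply_diag_eq F e TV hVd TW hWd y
  have hinv : (((ratSp F (gramDA F e TV TW) (isUnit_det_gramDA F e TV hVd TW hWd) (deltaD F))⁻¹).1 : _ ≃ₗ[AdeleRing (𝓞 F) F] _) (0, y) =
      (Sum.elim a a ∘ ⇑(e₂ (n := n)).symm, Sum.elim z z ∘ ⇑(e₂ (n := n)).symm) := by
    rw [← haz]
    exact ((ratSp F (gramDA F e TV TW) (isUnit_det_gramDA F e TV hVd TW hWd) (deltaD F)).1 : _ ≃ₗ[AdeleRing (𝓞 F) F] _).symm_apply_apply _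
  show (((ratSp F (gramDA F e TV TW) (isUnit_det_gramDA F e TV hVd TW hWd) (deltaD F)).1 : _ ≃ₗ[AdeleRing (𝓞 F) F] _)
    (((toSpD F E c hcδ hδ hd e TV hV TW hW p).1 : _ ≃ₗ[AdeleRing (𝓞 F) F] _)
      ((((ratSp F (gramDA F e TV TW) (isUnit_det_gramDA F e TV hVd TW hWd) (deltaD F))⁻¹).1 : _ ≃ₗ[AdeleRing (𝓞 F) F] _) (0, y)))).1 = 0
  rw [hinv, toSpD_apply_diag F E c hcδ hδ hd e TV hV TW hW p hS, ratSp_deltaD_apply_diag F e TV hVd TW hWd]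

end SiegelLagrangian

/-! ## §3 The `𝕐`-block at `∞` on diagonal archimedean pairs, in a real frame `eW` -/

section ArchFrame

variable {σ : Type*} [Fintype σ]
  (eW : (Fin (n + n) → mixedEmbedding.mixedSpace F) ≃L[ℝ] (σ → ℝ))

omit [Algebra.IsQuadraticExtension F E] in
/-- `archVec` of a doubled diagonal vector. [cite: Folland1989, §4.2 (4.24)] -/
theorem archVec_diag (a : Fin n → mixedEmbedding.mixedSpace F) :
    archVec F (Fin (n + n)) (Sum.elim a a ∘ ⇑(e₂ (n := n)).symm) =
      Sum.elim (archVec F (Fin n) a) (archVec F (Fin n) a) ∘ ⇑(e₂ (n := n)).symm := by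
  funext i
  refine Prod.ext ?_ ?_
  · rw [archVec_apply_fst, Function.comp_apply, Function.comp_apply]
    generalize (e₂ (n := n)).symm i = k
    cases k <;> rfl
  · rw [archVec_apply_snd, Function.comp_apply]
    generalize (e₂ (n := n)).symm i = k
    cases k <;> rfl

omit [Algebra.IsQuadraticExtension F E] in
/-- `piArch` of a re-enumerated `Sum.elim`. [cite: Folland1989, §4.2 (4.24)] -/
theorem piArch_sumElim (P Q : Fin n → AdeleRing (𝓞 F) F) :
    piArch F (Fin (n + n)) (Sum.elim P Q ∘ ⇑(e₂ (n := n)).symm) =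
      Sum.elim (piArch F (Fin n) P) (piArch F (Fin n) Q) ∘ ⇑(e₂ (n := n)).symm := by
  funext i
  rw [piArch_apply, Function.comp_apply, Function.comp_apply]
  generalize (e₂ (n := n)).symm i = k
  cases k <;> rfl

omit [Algebra.IsQuadraticExtension F E] in
/-- `piArch (T Y) = T_∞ (piArch Y)` for every adelic vector `Y`. [cite: Folland1989, §4.2 (4.24)] -/
theorem piArch_mulVec {m : Type} [Fintype m] (T : Matrix m m (AdeleRing (𝓞 F) F))
    (Y : m → AdeleRing (𝓞 F) F) :
    piArch F m (T *ᵥ Y) = archMat F m T *ᵥ piArch F m Y := by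
  funext i
  rw [piArch_apply, Matrix.mulVec, dotProduct, AdeleRing.fst_sum, map_sum, Matrix.mulVec, dotProduct]
  refine Finset.sum_congr rfl fun j _ => ?_
  rw [show (T i j * Y j).1 = (T i j).1 * (Y j).1 from rfl, map_mul, piArch_apply]
  rfl

omit [Algebra.IsQuadraticExtension F E] in
/-- `piArch (−Y) = −piArch Y`. [cite: Folland1989, §4.2 (4.24)] -/
theorem piArch_neg' {m : Type} (Y : m → AdeleRing (𝓞 F) F) : piArch F m (-Y) = -piArch F m Y := by
  funext i
  rw [piArch_apply, Pi.neg_apply, Pi.neg_apply, piArch_apply, show (-Y i).1 = -(Y i).1 from rfl, map_neg]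

include hVd hWd in
/-- the archimedean action of `δ` on a diagonal pair:
`archAct δ (diag a, diag z) = (0, (T^𝔻 ⊗ 1)_∞⁻¹ (T_∞ z ⊕ (−a)))`. [cite: Kudla1994, §3] -/
theorem archAct_deltaD_diag (a z : Fin n → mixedEmbedding.mixedSpace F) :
    archAct (gramDA F e TV TW) (ratSp F (gramDA F e TV TW) (isUnit_det_gramDA F e TV hVd TW hWd) (deltaD F))
        (Sum.elim a a ∘ ⇑(e₂ (n := n)).symm, Sum.elim z z ∘ ⇑(e₂ (n := n)).symm) =
      (0, archMat F (Fin (n + n)) (gramDA F e TV TW)⁻¹ *ᵥ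
        (Sum.elim (archMat F (Fin n) ((gramR F e TV TW).map (algebraMap F (AdeleRing (𝓞 F) F))) *ᵥ z)
          (-a) ∘ ⇑(e₂ (n := n)).symm)) := by
  unfold archAct
  rw [archVec_diag, archVec_diag, ratSp_deltaD_apply_diag F e TV hVd TW hWd]
  refine Prod.ext ?_ ?_
  · show piArch F (Fin (n + n)) 0 = 0
    exact piArch_zero F (Fin (n + n))
  · show piArch F (Fin (n + n)) _ = _
    rw [piArch_mulVec, piArch_sumElim, piArch_mulVec, piArch_archVec, piArch_neg', piArch_archVec]

include hVd hWd in
/-- **the frame `ψ` of `𝕐_∞` by diagonal archimedean pairs**: a real-linear equivalence `ψ : (a, z) ↦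
φ((T^𝔻 ⊗ 1)_∞⁻¹ (T_∞ z ⊕ (−a)))` with `S_δ(Ξ(diag a, diag z)) = (0, ψ(a, z))` in the frame `eW` — `δ` maps the
diagonal Lagrangian onto `𝕐` at `∞`. [cite: Folland1989, §4.2 (4.24)] -/
theorem exists_yFrame_diag :
    ∃ ψ : ((Fin n → mixedEmbedding.mixedSpace F) × (Fin n → mixedEmbedding.mixedSpace F)) ≃ₗ[ℝ] (σ → ℝ),
      ∀ az : (Fin n → mixedEmbedding.mixedSpace F) × (Fin n → mixedEmbedding.mixedSpace F),
        archPhaseMap (gramDA F e TV TW) eW (isUnit_archMat_gramDA F e TV hVd TW hWd)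
            (ratSp F (gramDA F e TV TW) (isUnit_det_gramDA F e TV hVd TW hWd) (deltaD F))
            (archFolland (gramDA F e TV TW) eW
              (Sum.elim az.1 az.1 ∘ ⇑(e₂ (n := n)).symm, Sum.elim az.2 az.2 ∘ ⇑(e₂ (n := n)).symm)) =
          (0, ψ az) := by
  have hR : IsUnit (archMat F (Fin n) ((gramR F e TV TW).map (algebraMap F (AdeleRing (𝓞 F) F)))) := by
    refine isUnit_archMat_of_isUnit _ ((Matrix.isUnit_iff_isUnit_det _).2 ?_)
    rw [← RingHom.mapMatrix_apply, ← RingHom.map_det]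
    exact (isUnit_det_gramR₀ F e TV hVd TW hWd).map _
  have hN : IsUnit (archMat F (Fin (n + n)) (gramDA F e TV TW)⁻¹) := by
    refine isUnit_archMat_of_isUnit _ ((Matrix.isUnit_iff_isUnit_det _).2 ?_)
    exact Matrix.isUnit_nonsing_inv_det _ (isUnit_det_gramDA F e TV hVd TW hWd)
  -- the diagonal packing `D(a, z) = (T_∞ z) ⊕ (−a)` (re-enumerated), real-linear and bijective
  obtain ⟨D, hD⟩ : ∃ D : ((Fin n → mixedEmbedding.mixedSpace F) × (Fin n → mixedEmbedding.mixedSpace F)) →ₗ[ℝ]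
      (Fin (n + n) → mixedEmbedding.mixedSpace F),
      ∀ az, D az = Sum.elim (archMat F (Fin n) ((gramR F e TV TW).map
        (algebraMap F (AdeleRing (𝓞 F) F))) *ᵥ az.2) (-az.1) ∘ ⇑(e₂ (n := n)).symm :=
    ⟨(LinearMap.funLeft ℝ (mixedEmbedding.mixedSpace F) ⇑(e₂ (n := n)).symm :
        (Fin n ⊕ Fin n → mixedEmbedding.mixedSpace F) →ₗ[ℝ] (Fin (n + n) → mixedEmbedding.mixedSpace F)) ∘ₗ
      (LinearEquiv.sumArrowLequivProdArrow (Fin n) (Fin n) ℝ (mixedEmbedding.mixedSpace F)).symm.toLinearMap ∘ₗ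
      (((Matrix.toLin' (archMat F (Fin n) ((gramR F e TV TW).map
          (algebraMap F (AdeleRing (𝓞 F) F))))).restrictScalars ℝ :
          (Fin n → mixedEmbedding.mixedSpace F) →ₗ[ℝ] (Fin n → mixedEmbedding.mixedSpace F)).prodMap
        (-LinearMap.id : (Fin n → mixedEmbedding.mixedSpace F) →ₗ[ℝ] (Fin n → mixedEmbedding.mixedSpace F))) ∘ₗ
      (LinearEquiv.prodComm ℝ (Fin n → mixedEmbedding.mixedSpace F) (Fin n → mixedEmbedding.mixedSpace F)).toLinearMap,
      fun _ => rfl⟩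
  have hDb : Function.Bijective D := by
    have hb := mulVec_bijective_of_isUnit hR
    constructor
    · intro x y h
      rw [hD, hD] at h
      have h' := congrArg (fun f => f ∘ ⇑(e₂ (n := n))) h
      simp only [Function.comp_assoc, Equiv.symm_comp_self, Function.comp_id] at h'
      have h1 := congrArg (fun f => f ∘ Sum.inl) h'
      have h2 := congrArg (fun f => f ∘ Sum.inr) h'
      simp only [Sum.elim_comp_inl, Sum.elim_comp_inr, neg_inj] at h1 h2
      exact Prod.ext h2 (hb.1 h1)
    · intro f
      obtain ⟨z, hz⟩ := hb.2 (f ∘ ⇑(e₂ (n := n)) ∘ Sum.inl)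
      refine ⟨(-(f ∘ ⇑(e₂ (n := n)) ∘ Sum.inr), z), ?_⟩
      rw [hD]
      funext x
      obtain ⟨k, rfl⟩ := (e₂ (n := n)).surjective x
      rw [Function.comp_apply, Equiv.symm_apply_apply]
      cases k with
      | inl j => exact congrFun hz j
      | inr j => simp only [Sum.elim_inr, neg_neg, Function.comp_apply]
  -- `ψ = φ ∘ (T^𝔻 ⊗ 1)_∞⁻¹ ∘ D`
  obtain ⟨ψ, hψ⟩ : ∃ ψ : ((Fin n → mixedEmbedding.mixedSpace F) × (Fin n → mixedEmbedding.mixedSpace F)) →ₗ[ℝ]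
      (σ → ℝ), ∀ az, ψ az = freqFrame (gramDA F e TV TW) eW (isUnit_archMat_gramDA F e TV hVd TW hWd)
        (archMat F (Fin (n + n)) (gramDA F e TV TW)⁻¹ *ᵥ D az) :=
    ⟨(freqFrame (gramDA F e TV TW) eW (isUnit_archMat_gramDA F e TV hVd TW hWd)).toLinearMap ∘ₗ
      ((Matrix.toLin' (archMat F (Fin (n + n)) (gramDA F e TV TW)⁻¹)).restrictScalars ℝ :
        (Fin (n + n) → mixedEmbedding.mixedSpace F) →ₗ[ℝ] (Fin (n + n) → mixedEmbedding.mixedSpace F)) ∘ₗ D,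
      fun _ => rfl⟩
  have hψb : Function.Bijective ψ := by
    have hcomp : (ψ : _ → σ → ℝ) = (freqFrame (gramDA F e TV TW) eW
        (isUnit_archMat_gramDA F e TV hVd TW hWd)) ∘
        (fun w => archMat F (Fin (n + n)) (gramDA F e TV TW)⁻¹ *ᵥ w) ∘ D := funext fun az => hψ az
    rw [hcomp]
    exact ((freqFrame (gramDA F e TV TW) eW
      (isUnit_archMat_gramDA F e TV hVd TW hWd)).bijective.comp (mulVec_bijective_of_isUnit hN)).comp hDb
  refine ⟨LinearEquiv.ofBijective ψ hψb, fun az => ?_⟩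
  rw [archPhaseMap_archFolland, archAct_deltaD_diag F e TV hVd TW hWd,
    archFolland_zero _ _ (isUnit_archMat_gramDA F e TV hVd TW hWd), LinearEquiv.ofBijective_apply, hψ, hD]

include hVd hWd in
/-- **`det d = det A`**: if the archimedean action of `q ∈ Sp(𝕎^𝔻_𝔸)` maps diagonal pairs to diagonal pairs through a
real-linear `A` (for `q = ι^𝔻(p)`, `p ∈ P_Δ`, it does, through `Res(δ_Δ(p))`), then the `𝕐`-block `d` of `δ q δ⁻¹` at
`∞` in the frame `eW` is `ψ A ψ⁻¹`, so `det d = det A`. [cite: Kudla1994, §3] -/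
theorem det_yBlock_eq_det [DecidableEq σ]
    (q : symplecticGroup (polar (adelicForm F (Fin (n + n)) (gramDA F e TV TW))))
    (A : ((Fin n → mixedEmbedding.mixedSpace F) × (Fin n → mixedEmbedding.mixedSpace F)) ≃ₗ[ℝ]
      ((Fin n → mixedEmbedding.mixedSpace F) × (Fin n → mixedEmbedding.mixedSpace F)))
    (hA : ∀ az : (Fin n → mixedEmbedding.mixedSpace F) × (Fin n → mixedEmbedding.mixedSpace F),
      archAct (gramDA F e TV TW) q
          (Sum.elim az.1 az.1 ∘ ⇑(e₂ (n := n)).symm, Sum.elim az.2 az.2 ∘ ⇑(e₂ (n := n)).symm) =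
        (Sum.elim (A az).1 (A az).1 ∘ ⇑(e₂ (n := n)).symm, Sum.elim (A az).2 (A az).2 ∘ ⇑(e₂ (n := n)).symm))
    (d : (σ → ℝ) ≃ₗ[ℝ] (σ → ℝ))
    (hd : ∀ y, d y = (archPhaseMap (gramDA F e TV TW) eW (isUnit_archMat_gramDA F e TV hVd TW hWd)
      (ratSp F (gramDA F e TV TW) (isUnit_det_gramDA F e TV hVd TW hWd) (deltaD F) * q *
        (ratSp F (gramDA F e TV TW) (isUnit_det_gramDA F e TV hVd TW hWd) (deltaD F))⁻¹) (0, y)).2) :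
    LinearMap.det (d : (σ → ℝ) →ₗ[ℝ] (σ → ℝ)) =
      LinearMap.det (A : ((Fin n → mixedEmbedding.mixedSpace F) × (Fin n → mixedEmbedding.mixedSpace F)) →ₗ[ℝ]
        ((Fin n → mixedEmbedding.mixedSpace F) × (Fin n → mixedEmbedding.mixedSpace F))) := by
  obtain ⟨ψ, hψ⟩ := exists_yFrame_diag F e TV hVd TW hWd eW
  -- `d (ψ az) = ψ (A az)`
  have key : ∀ az : (Fin n → mixedEmbedding.mixedSpace F) × (Fin n → mixedEmbedding.mixedSpace F),
      d (ψ az) = ψ (A az) := by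
    intro az
    have h1 := hψ az
    have h2 := hψ (A az)
    -- `S_δ⁻¹ (0, ψ az) = Ξ (diag az)`
    have h3 : archPhaseMap (gramDA F e TV TW) eW (isUnit_archMat_gramDA F e TV hVd TW hWd)
        (ratSp F (gramDA F e TV TW) (isUnit_det_gramDA F e TV hVd TW hWd) (deltaD F))⁻¹ (0, ψ az) =
        archFolland (gramDA F e TV TW) eW
          (Sum.elim az.1 az.1 ∘ ⇑(e₂ (n := n)).symm, Sum.elim az.2 az.2 ∘ ⇑(e₂ (n := n)).symm) := by
      rw [← h1, ← archPhaseMap_mul, inv_mul_cancel, archPhaseMap_one]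
    rw [hd, archPhaseMap_mul, archPhaseMap_mul, h3, archPhaseMap_archFolland, hA az, h2]
  have hconj : (d : (σ → ℝ) →ₗ[ℝ] (σ → ℝ)) =
      ψ.toLinearMap ∘ₗ
        (A : ((Fin n → mixedEmbedding.mixedSpace F) × (Fin n → mixedEmbedding.mixedSpace F)) →ₗ[ℝ]
          ((Fin n → mixedEmbedding.mixedSpace F) × (Fin n → mixedEmbedding.mixedSpace F))) ∘ₗ
          ψ.symm.toLinearMap := by
    apply LinearMap.ext
    intro y
    obtain ⟨az, rfl⟩ := ψ.surjective y
    simp only [LinearMap.comp_apply, LinearEquiv.coe_coe, LinearEquiv.symm_apply_apply]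
    exact key az
  rw [hconj, LinearMap.det_conj]

end ArchFrame

end Literature.NumberTheory.GelbartRogawski1991.GRConstructionGen

end
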